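import Summits.CriticalPhenomena.CardyFormulaZ2.Theorems.CardyUniqueLimitCardyRigidityTestFunction
import Summits.CriticalPhenomena.CardyFormulaZ2.Theorems.CardyUniqueLimitCardyRigidityPushforward
import Mathlib.MeasureTheory.Group.Integral
import HarnessLib

/-!
# Test-function calculus on an open interval, II: the regularity bootstrap

Sub-problem `CriticalPhenomena/CardyFormulaZ2`; crux
`Summit.CriticalPhenomena.CardyFormulaZ2.Theses.CardyUniqueLimit.CardyRigidity`
(stmt-CriticalPhenomena-0746), line `crossing_martingale` (skeleton `Lines/crossing_martingale.lean`,
definitions module `Theorems/CardyUniqueLimitCardyRigidityDefs.lean`), STUB C `stub_kernelAffineBeta`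
("a crossing-martingale kernel is affine-beta", general continuous `f`).

`TestFunction.bootstrap` (registered glue sub-goal `testFunction_bootstrap`): if `F` is continuous
on an open interval `(L, R)`, `w ∈ C¹(L, R)`, and `κ ∫ F ψ'' = ∫ F (w ψ)'` for every test function
`ψ` of the interval, then for `κ ≠ 0` the function `F` is `C²` with `κ F'' + w F' = 0` classically,
and for `κ = 0 < w` it is constant.  Proof: with the primitives `P' = F w`, `Q₁' = F w'`,
`Q₂' = Q₁`, two integrations by parts give `∫ (κ F + P - Q₂) ψ'' = 0`, so `κ F + P - Q₂` is affine
(du Bois-Reymond of order two, file I), whence `F ∈ C¹`, then `C²`, and the equation.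

Appendix (for the probabilistic half C1 of STUB C): the exact shift
`∫ F(θ - w) ψ(θ) dθ = ∫ F(θ) ψ(θ + w) dθ` (`TestFunction.integral_shift`) and the Taylor bound
`|ψ(θ+w) - ψ(θ) - wψ'(θ) - (w²/2)ψ''(θ)| ≤ ‖ψ'''‖ |w|³` (`TestFunction.taylor_shift_bound`).

References: du Bois-Reymond (1879); Hörmander, *ALPDO I*, Thm 3.1.4 and Cor. 3.1.6.
-/

noncomputable section

open MeasureTheory Filter Set Topology

namespace Summit.CriticalPhenomena.CardyFormulaZ2.Cruxes.CardyRigidity.CrossingMartingale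

namespace TestFunction

/-- Derivatives of test functions are test functions. [folklore] -/
theorem contDiff_deriv_test {ψ : ℝ → ℝ} (hψ : ContDiff ℝ (⊤ : ℕ∞) ψ) :
    ContDiff ℝ (⊤ : ℕ∞) (deriv ψ) :=
  (contDiff_infty_iff_deriv.1 hψ).2

/-- Test functions are differentiable. [folklore] -/
theorem hasDerivAt_test {ψ : ℝ → ℝ} (hψ : ContDiff ℝ (⊤ : ℕ∞) ψ) (θ : ℝ) :
    HasDerivAt ψ (deriv ψ θ) θ :=
  ((contDiff_infty_iff_deriv.1 hψ).1 θ).hasDerivAt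

/-- A primitive of a function continuous on an open interval, based inside it, is
differentiable there with the expected derivative. [folklore] -/
theorem hasDerivAt_primitive {g : ℝ → ℝ} {L R θ₀ θ : ℝ} (hg : ContinuousOn g (Ioo L R))
    (hθ₀ : θ₀ ∈ Ioo L R) (hθ : θ ∈ Ioo L R) :
    HasDerivAt (fun θ ↦ ∫ x in θ₀..θ, g x) (g θ) θ := by
  have hsub : uIcc θ₀ θ ⊆ Ioo L R := by
    rcases le_total θ₀ θ with h | h
    · rw [uIcc_of_le h]; exact Icc_subset_Ioo hθ₀.1 hθ.2
    · rw [uIcc_of_ge h]; exact Icc_subset_Ioo hθ.1 hθ₀.2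
  exact intervalIntegral.integral_hasDerivAt_right ((hg.mono hsub).intervalIntegrable)
    (hg.stronglyMeasurableAtFilter isOpen_Ioo θ hθ) (hg.continuousAt (Ioo_mem_nhds hθ.1 hθ.2))

/-- **Regularity bootstrap.** If `F` is continuous on an open interval and
`κ ∫ F ψ'' = ∫ F (w ψ)'` for every test function `ψ` of the interval (`w ∈ C¹`), then:
for `κ ≠ 0`, `F ∈ C²` and `κ F'' + w F' = 0` classically; for `κ = 0` and `w > 0`, `F` is
constant. [folklore] -/
theorem bootstrap {F w w' : ℝ → ℝ} {L R κ : ℝ} (hLR : L < R) (hF : ContinuousOn F (Ioo L R))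
    (hw : ∀ θ ∈ Ioo L R, HasDerivAt w (w' θ) θ) (hw' : ContinuousOn w' (Ioo L R))
    (h : ∀ ψ : ℝ → ℝ, ContDiff ℝ (⊤ : ℕ∞) ψ → HasCompactSupport ψ → tsupport ψ ⊆ Ioo L R →
      κ * ∫ θ, F θ * deriv (deriv ψ) θ = ∫ θ, F θ * deriv (fun θ ↦ w θ * ψ θ) θ) :
    (κ = 0 → (∀ θ ∈ Ioo L R, 0 < w θ) → ∃ c : ℝ, EqOn F (fun _ ↦ c) (Ioo L R)) ∧
    (κ ≠ 0 → ∃ F' F'' : ℝ → ℝ, (∀ θ ∈ Ioo L R, HasDerivAt F (F' θ) θ) ∧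
      (∀ θ ∈ Ioo L R, HasDerivAt F' (F'' θ) θ) ∧ ∀ θ ∈ Ioo L R, κ * F'' θ + w θ * F' θ = 0) := by
  have hwc : ContinuousOn w (Ioo L R) := fun θ hθ ↦ (hw θ hθ).continuousAt.continuousWithinAt
  set θ₀ : ℝ := (L + R) / 2 with hθ₀
  have hθ₀I : θ₀ ∈ Ioo L R := ⟨by rw [hθ₀]; linarith, by rw [hθ₀]; linarith⟩
  -- the primitives `P' = F w`, `Q₁' = F w'`, `Q₂' = Q₁`
  set P : ℝ → ℝ := fun θ ↦ ∫ x in θ₀..θ, F x * w x with hP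
  set Q₁ : ℝ → ℝ := fun θ ↦ ∫ x in θ₀..θ, F x * w' x with hQ₁
  set Q₂ : ℝ → ℝ := fun θ ↦ ∫ x in θ₀..θ, Q₁ x with hQ₂
  have hFw : ContinuousOn (fun θ ↦ F θ * w θ) (Ioo L R) := hF.mul hwc
  have hFw' : ContinuousOn (fun θ ↦ F θ * w' θ) (Ioo L R) := hF.mul hw'
  have hP' : ∀ θ ∈ Ioo L R, HasDerivAt P (F θ * w θ) θ := fun θ hθ ↦
    hasDerivAt_primitive hFw hθ₀I hθ
  have hQ₁' : ∀ θ ∈ Ioo L R, HasDerivAt Q₁ (F θ * w' θ) θ := fun θ hθ ↦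
    hasDerivAt_primitive hFw' hθ₀I hθ
  have hQ₁c : ContinuousOn Q₁ (Ioo L R) := fun θ hθ ↦ (hQ₁' θ hθ).continuousAt.continuousWithinAt
  have hQ₂' : ∀ θ ∈ Ioo L R, HasDerivAt Q₂ (Q₁ θ) θ := fun θ hθ ↦
    hasDerivAt_primitive hQ₁c hθ₀I hθ
  have hPc : ContinuousOn P (Ioo L R) := fun θ hθ ↦ (hP' θ hθ).continuousAt.continuousWithinAt
  have hQ₂c : ContinuousOn Q₂ (Ioo L R) := fun θ hθ ↦ (hQ₂' θ hθ).continuousAt.continuousWithinAt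
  -- the identity `∫ (κ F + P - Q₂) ψ'' = 0`
  have key : ∀ ψ : ℝ → ℝ, ContDiff ℝ (⊤ : ℕ∞) ψ → HasCompactSupport ψ → tsupport ψ ⊆ Ioo L R →
      ∫ θ, (κ * F θ + P θ - Q₂ θ) * deriv (deriv ψ) θ = 0 := by
    intro ψ hψ hψc hψs
    have hψ' := contDiff_deriv_test hψ
    have hψ'' := contDiff_deriv_test hψ'
    have hψ'c : HasCompactSupport (deriv ψ) := hψc.deriv
    have hψ''c : HasCompactSupport (deriv (deriv ψ)) := hψ'c.deriv
    have hψ's : tsupport (deriv ψ) ⊆ Ioo L R := tsupport_deriv_subset.trans hψs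
    have hψ''s : tsupport (deriv (deriv ψ)) ⊆ Ioo L R := tsupport_deriv_subset.trans hψ's
    -- `(w ψ)' = w' ψ + w ψ'` everywhere
    have hprod : (fun θ ↦ F θ * deriv (fun θ ↦ w θ * ψ θ) θ) =
        fun θ ↦ F θ * w' θ * ψ θ + F θ * w θ * deriv ψ θ := by
      funext θ
      by_cases hθ : θ ∈ Ioo L R
      · have hd : HasDerivAt (fun θ ↦ w θ * ψ θ) (w' θ * ψ θ + w θ * deriv ψ θ) θ :=
          (hw θ hθ).mul (hasDerivAt_test hψ θ)
        rw [hd.deriv]; ring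
      · have hθ' : θ ∉ tsupport ψ := fun hh ↦ hθ (hψs hh)
        have hψ0 : ψ θ = 0 := image_eq_zero_of_notMem_tsupport hθ'
        have hdψ0 : deriv ψ θ = 0 :=
          image_eq_zero_of_notMem_tsupport fun hh ↦ hθ' (tsupport_deriv_subset hh)
        have hloc : (fun θ ↦ w θ * ψ θ) =ᶠ[𝓝 θ] fun _ ↦ 0 := by
          filter_upwards [notMem_tsupport_iff_eventuallyEq.1 hθ'] with x hx
          simp [hx]
        rw [hloc.deriv_eq, hψ0, hdψ0]; simp
    have h1 : ∫ θ, F θ * deriv (fun θ ↦ w θ * ψ θ) θ =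
        (∫ θ, F θ * w' θ * ψ θ) + ∫ θ, F θ * w θ * deriv ψ θ := by
      rw [hprod]
      exact MeasureTheory.integral_add (integrable_mul_test hFw' hψ.continuous hψc hψs)
        (integrable_mul_test hFw hψ'.continuous hψ'c hψ's)
    -- `∫ F w ψ' = -∫ P ψ''`
    have h2 : ∫ θ, F θ * w θ * deriv ψ θ = -∫ θ, P θ * deriv (deriv ψ) θ := by
      rw [integral_mul_deriv_test hLR hP' hFw hψ' hψ'c hψ's, neg_neg]
    -- `∫ F w' ψ = -∫ Q₁ ψ' = ∫ Q₂ ψ''`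
    have h3 : ∫ θ, F θ * w' θ * ψ θ = ∫ θ, Q₂ θ * deriv (deriv ψ) θ := by
      rw [integral_mul_deriv_test hLR hQ₂' hQ₁c hψ' hψ'c hψ's,
        integral_mul_deriv_test hLR hQ₁' hFw' hψ hψc hψs, neg_neg]
    have h0 := h ψ hψ hψc hψs
    rw [h1, h2, h3] at h0
    have hiF := integrable_mul_test hF hψ''.continuous hψ''c hψ''s
    have hiP := integrable_mul_test hPc hψ''.continuous hψ''c hψ''s
    have hiQ := integrable_mul_test hQ₂c hψ''.continuous hψ''c hψ''s
    have h4 : ∫ θ, (κ * F θ + P θ - Q₂ θ) * deriv (deriv ψ) θ =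
        κ * (∫ θ, F θ * deriv (deriv ψ) θ) + (∫ θ, P θ * deriv (deriv ψ) θ) -
          ∫ θ, Q₂ θ * deriv (deriv ψ) θ := by
      simp only [add_mul, sub_mul]
      rw [MeasureTheory.integral_sub, MeasureTheory.integral_add, ← MeasureTheory.integral_const_mul]
      · congr 2
        exact integral_congr_ae (Eventually.of_forall fun θ ↦ by simp only; ring)
      · exact (hiF.const_mul κ).congr (Eventually.of_forall fun θ ↦ by simp only; ring)
      · exact hiP
      · exact ((hiF.const_mul κ).congr (Eventually.of_forall fun θ ↦ by simp only; ring)).add hiP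
      · exact hiQ
    rw [h4]
    linarith
  have hUc : ContinuousOn (fun θ ↦ κ * F θ + P θ - Q₂ θ) (Ioo L R) :=
    ((continuousOn_const.mul hF).add hPc).sub hQ₂c
  obtain ⟨α, β, hαβ⟩ := eqOn_affine_of_integral_deriv_deriv hLR hUc key
  refine ⟨fun hκ hwpos ↦ ?_, fun hκ ↦ ?_⟩
  · -- κ = 0: `P = Q₂ + α θ + β`, so `F w = Q₁ + α` is `C¹` with `(F w)' = F w'`, whence `F' = 0`
    have hPQ : EqOn P (fun θ ↦ Q₂ θ + α * θ + β) (Ioo L R) := by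
      intro θ hθ
      have := hαβ hθ
      simp only [hκ, zero_mul, zero_add] at this
      simp only
      linarith
    have hFwQ : ∀ θ ∈ Ioo L R, F θ * w θ = Q₁ θ + α := by
      intro θ hθ
      have h1 : HasDerivAt P (Q₁ θ + α) θ := by
        have h2 : HasDerivAt (fun θ ↦ Q₂ θ + α * θ + β) (Q₁ θ + α * 1 + 0) θ :=
          (((hQ₂' θ hθ).add ((hasDerivAt_id θ).const_mul α)).add (hasDerivAt_const θ β))
        rw [mul_one, add_zero] at h2
        exact h2.congr_of_eventuallyEq (hPQ.eventuallyEq_of_mem (isOpen_Ioo.mem_nhds hθ))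
      exact (hP' θ hθ).unique h1
    have hFeq : EqOn F (fun θ ↦ (Q₁ θ + α) / w θ) (Ioo L R) := by
      intro θ hθ
      simp only
      rw [← hFwQ θ hθ, mul_div_cancel_right₀ _ (hwpos θ hθ).ne']
    have hFd : ∀ θ ∈ Ioo L R, HasDerivAt F 0 θ := by
      intro θ hθ
      have hwθ := (hwpos θ hθ).ne'
      have h1 : HasDerivAt (fun θ ↦ (Q₁ θ + α) / w θ)
          (((F θ * w' θ + 0) * w θ - (Q₁ θ + α) * w' θ) / w θ ^ 2) θ :=
        ((hQ₁' θ hθ).add (hasDerivAt_const θ α)).div (hw θ hθ) hwθ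
      have h2 : ((F θ * w' θ + 0) * w θ - (Q₁ θ + α) * w' θ) / w θ ^ 2 = 0 := by
        rw [← hFwQ θ hθ]; ring
      rw [h2] at h1
      exact h1.congr_of_eventuallyEq (hFeq.eventuallyEq_of_mem (isOpen_Ioo.mem_nhds hθ))
    refine ⟨F θ₀, fun θ hθ ↦ ?_⟩
    exact isOpen_Ioo.is_const_of_deriv_eq_zero isPreconnected_Ioo
      (fun x hx ↦ (hFd x hx).differentiableAt.differentiableWithinAt)
      (fun x hx ↦ (hFd x hx).deriv) hθ hθ₀I
  · -- κ ≠ 0: `F = (α θ + β - P + Q₂)/κ` is `C¹`, then `C²`, with `κ F'' = -w F'`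
    have hFeq : EqOn F (fun θ ↦ (α * θ + β - P θ + Q₂ θ) / κ) (Ioo L R) := by
      intro θ hθ
      have := hαβ hθ
      simp only at this ⊢
      field_simp
      linarith
    set F' : ℝ → ℝ := fun θ ↦ (α - F θ * w θ + Q₁ θ) / κ with hF'
    have hFd : ∀ θ ∈ Ioo L R, HasDerivAt F (F' θ) θ := by
      intro θ hθ
      have h1 : HasDerivAt (fun θ ↦ (α * θ + β - P θ + Q₂ θ) / κ)
          ((α * 1 + 0 - F θ * w θ + Q₁ θ) / κ) θ :=
        (((((hasDerivAt_id θ).const_mul α).add (hasDerivAt_const θ β)).sub (hP' θ hθ)).add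
          (hQ₂' θ hθ)).div_const κ
      rw [mul_one, add_zero] at h1
      exact h1.congr_of_eventuallyEq (hFeq.eventuallyEq_of_mem (isOpen_Ioo.mem_nhds hθ))
    set F'' : ℝ → ℝ := fun θ ↦ -(w θ * F' θ) / κ with hF''
    have hF'd : ∀ θ ∈ Ioo L R, HasDerivAt F' (F'' θ) θ := by
      intro θ hθ
      have h1 : HasDerivAt F' ((0 - (F' θ * w θ + F θ * w' θ) + F θ * w' θ) / κ) θ :=
        (((hasDerivAt_const θ α).sub ((hFd θ hθ).mul (hw θ hθ))).add (hQ₁' θ hθ)).div_const κ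
      refine h1.congr_deriv ?_
      simp only [hF'']
      ring
    refine ⟨F', F'', hFd, hF'd, fun θ _ ↦ ?_⟩
    simp only [hF'']
    field_simp
    ring

/-! ### Shifting the argument onto the test function (used by the far-field expansion, C1) -/

/-- **Shift of the argument onto the test function**: `∫ F(θ - w) ψ(θ) dθ = ∫ F(θ) ψ(θ + w) dθ`.
[folklore] -/
theorem integral_shift (F ψ : ℝ → ℝ) (w : ℝ) :
    ∫ θ, F (θ - w) * ψ θ = ∫ θ, F θ * ψ (θ + w) := by
  have := MeasureTheory.integral_add_right_eq_self (μ := volume) (fun θ ↦ F (θ - w) * ψ θ) w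
  simp only [add_sub_cancel_right] at this
  exact this.symm

/-- **Taylor expansion of a shifted test function to second order** with a third-derivative
remainder: `|ψ(θ+w) - ψ(θ) - w ψ'(θ) - (w²/2) ψ''(θ)| ≤ M₃ |w|³`. [folklore] -/
theorem taylor_shift_bound {ψ ψ₁ ψ₂ ψ₃ : ℝ → ℝ} {M₃ : ℝ} (h₁ : ∀ θ, HasDerivAt ψ (ψ₁ θ) θ)
    (h₂ : ∀ θ, HasDerivAt ψ₁ (ψ₂ θ) θ) (h₃ : ∀ θ, HasDerivAt ψ₂ (ψ₃ θ) θ)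
    (hM : ∀ θ, |ψ₃ θ| ≤ M₃) (θ w : ℝ) :
    |ψ (θ + w) - ψ θ - w * ψ₁ θ - w ^ 2 / 2 * ψ₂ θ| ≤ M₃ * |w| ^ 3 := by
  have hM0 : 0 ≤ M₃ := (abs_nonneg _).trans (hM 0)
  -- the remainders as functions of the shift `s`
  set r : ℝ → ℝ := fun s ↦ ψ (θ + s) - ψ θ - s * ψ₁ θ - s ^ 2 / 2 * ψ₂ θ with hr
  set r₁ : ℝ → ℝ := fun s ↦ ψ₁ (θ + s) - ψ₁ θ - s * ψ₂ θ with hr₁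
  set r₂ : ℝ → ℝ := fun s ↦ ψ₂ (θ + s) - ψ₂ θ with hr₂
  have hr' : ∀ s, HasDerivAt r (r₁ s) s := by
    intro s
    have h := ((((h₁ (θ + s)).comp s ((hasDerivAt_id' s).const_add θ)).sub
      (hasDerivAt_const s (ψ θ))).sub ((hasDerivAt_id' s).mul_const (ψ₁ θ))).sub
      (((hasDerivAt_pow 2 s).div_const 2).mul_const (ψ₂ θ))
    refine h.congr_deriv ?_
    simp only [hr₁]
    ring
  have hr₁' : ∀ s, HasDerivAt r₁ (r₂ s) s := by
    intro s
    have h := (((h₂ (θ + s)).comp s ((hasDerivAt_id' s).const_add θ)).sub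
      (hasDerivAt_const s (ψ₁ θ))).sub ((hasDerivAt_id' s).mul_const (ψ₂ θ))
    refine h.congr_deriv ?_
    simp only [hr₂]
    ring
  -- `|r₂ s| ≤ M₃ |s| ≤ M₃ |w|` on the segment
  have hseg : ∀ s ∈ uIcc 0 w, |s| ≤ |w| := by
    intro s hs
    rcases le_total 0 w with hw | hw
    · rw [uIcc_of_le hw] at hs
      rw [abs_of_nonneg hs.1, abs_of_nonneg hw]; exact hs.2
    · rw [uIcc_of_ge hw] at hs
      rw [abs_of_nonpos hs.2, abs_of_nonpos hw]; linarith [hs.1]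
  have hb₂ : ∀ s ∈ uIcc 0 w, |r₂ s| ≤ M₃ * |w| := by
    intro s hs
    have := Pushforward.abs_sub_le_of_deriv_bound h₃ hM θ (θ + s)
    simp only [hr₂, add_sub_cancel_left] at this ⊢
    exact this.trans (mul_le_mul_of_nonneg_left (hseg s hs) hM0)
  have hb₁ : ∀ s ∈ uIcc 0 w, |r₁ s| ≤ M₃ * |w| * |w| := by
    intro s hs
    have h0 : (0 : ℝ) ∈ uIcc 0 w := left_mem_uIcc
    have := Convex.norm_image_sub_le_of_norm_hasDerivWithin_le (f := r₁) (f' := r₂)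
      (fun x _ ↦ (hr₁' x).hasDerivWithinAt) (fun x hx ↦ by
        simpa [Real.norm_eq_abs] using hb₂ x hx) (convex_uIcc 0 w) h0 hs
    have hr₁0 : r₁ 0 = 0 := by simp [hr₁]
    rw [hr₁0, sub_zero, Real.norm_eq_abs, Real.norm_eq_abs, sub_zero] at this
    exact this.trans (mul_le_mul_of_nonneg_left (hseg s hs) (by positivity))
  have hb₀ : |r w| ≤ M₃ * |w| * |w| * |w| := by
    have h0 : (0 : ℝ) ∈ uIcc 0 w := left_mem_uIcc
    have := Convex.norm_image_sub_le_of_norm_hasDerivWithin_le (f := r) (f' := r₁)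
      (fun x _ ↦ (hr' x).hasDerivWithinAt) (fun x hx ↦ by
        simpa [Real.norm_eq_abs] using hb₁ x hx) (convex_uIcc 0 w) h0 right_mem_uIcc
    have hr0 : r 0 = 0 := by simp [hr]
    rw [hr0, sub_zero, Real.norm_eq_abs, Real.norm_eq_abs, sub_zero] at this
    exact this
  have : r w = ψ (θ + w) - ψ θ - w * ψ₁ θ - w ^ 2 / 2 * ψ₂ θ := rfl
  rw [← this]
  calc |r w| ≤ M₃ * |w| * |w| * |w| := hb₀
    _ = M₃ * |w| ^ 3 := by ring


end TestFunction

/-- **The regularity bootstrap** (registered glue sub-goal of stmt-CriticalPhenomena-0746, STUB C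
toolkit): `κ ∫ F ψ'' = ∫ F (w ψ)'` for all test functions forces, for `κ ≠ 0`, `F ∈ C²` with
`κ F'' + w F' = 0`, and for `κ = 0 < w`, `F` constant. [folklore] -/
theorem testFunction_bootstrap : ∀ {F w w' : ℝ → ℝ} {L R κ : ℝ}, L < R → ContinuousOn F (Ioo L R) → (∀ θ ∈ Ioo L R, HasDerivAt w (w' θ) θ) → ContinuousOn w' (Ioo L R) → (∀ ψ : ℝ → ℝ, ContDiff ℝ (⊤ : ℕ∞) ψ → HasCompactSupport ψ → tsupport ψ ⊆ Ioo L R → κ * ∫ θ, F θ * deriv (deriv ψ) θ = ∫ θ, F θ * deriv (fun θ ↦ w θ * ψ θ) θ) → (κ = 0 → (∀ θ ∈ Ioo L R, 0 < w θ) → ∃ c : ℝ, EqOn F (fun _ ↦ c) (Ioo L R)) ∧ (κ ≠ 0 → ∃ F' F'' : ℝ → ℝ, (∀ θ ∈ Ioo L R, HasDerivAt F (F' θ) θ) ∧ (∀ θ ∈ Ioo L R, HasDerivAt F' (F'' θ) θ) ∧ ∀ θ ∈ Ioo L R, κ * F'' θ + w θ * F' θ = 0) :=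
  fun hLR hF hw hw' h ↦ TestFunction.bootstrap hLR hF hw hw' h

end Summit.CriticalPhenomena.CardyFormulaZ2.Cruxes.CardyRigidity.CrossingMartingale

end
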